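import Mathlib
import Literature.Probability.LatticeModels.CorrelationDecayProofs
import HarnessLib

/-!
# Step functions attached to a series, and two filter facts on `ℤ³`

Helper file for item `stmt-CriticalPhenomena-8360`
(`Summit.CriticalPhenomena.Ising3DConformalLimit.Theses.BernsteinTemperature.KernelTransfer`):
the Abelian summation `Σ_n s_n q_n(x) ~ c |x|^{-(3-γ/ν)}` is carried out by writing the series as the
integral over `(0, ∞)` of a step function in the variable `u = n / |x|^{1/ν}` (two consecutive orders
`n ∈ {2k, 2k+1}` per cell, to absorb the parity constraint of the high-temperature kernels) and
applying dominated convergence along the cofinite filter of `ℤ³`.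

This file: measurability of the step function `u ↦ (L/2)(b_{2k} + b_{2k+1})`, `k = ⌊uL/2⌋`, and the
identity `∫_{(0,∞)} (L/2)(b_{2k} + b_{2k+1}) du = Σ_n b_n` for a non-negative summable `b`
(`integral_step_eq_tsum`); the cofinite filter of a countable type is countably generated; the
Euclidean norm tends to `∞` along the cofinite filter of `ℤ^d`; and four elementary facts used in
the dominated-convergence step (a convergent sequence gives a growth bound; continuity, positivity
somewhere and positivity of the integral of the limit profile `C u^{γ-1-3ν} Q(u^{-ν})`).
No definitions are introduced.
-/

noncomputable section

namespace Summit.CriticalPhenomena.Ising3DConformalLimit.Theorems.KernelTransfer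

open Filter Topology MeasureTheory Set
open Literature.Probability.LatticeModels

/-! ### Two filter facts -/

/-- The cofinite filter of a countable type is countably generated (basis: complements of finite
sets, indexed by `Finset`). -/
theorem isCountablyGenerated_cofinite {α : Type*} [Countable α] :
    (cofinite : Filter α).IsCountablyGenerated := by
  have h : (cofinite : Filter α).HasBasis (fun _ : Finset α => True) (fun s => (↑s : Set α)ᶜ) :=
    hasBasis_cofinite.to_hasBasis (fun s hs => ⟨hs.toFinset, trivial, by simp⟩)
      (fun s _ => ⟨↑s, s.finite_toSet, le_rfl⟩)
  exact h.isCountablyGenerated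

/-- The Euclidean norm `|x|₂ = √(Σᵢ xᵢ²)` dominates the sup norm of `ℤ^d`. -/
theorem norm_le_sqrt_sum_sq {d : ℕ} (x : Site d) : ‖x‖ ≤ Real.sqrt (∑ i, ((x i : ℝ)) ^ 2) := by
  refine (pi_norm_le_iff_of_nonneg (Real.sqrt_nonneg _)).2 fun i => ?_
  rw [Int.norm_eq_abs]
  refine Real.abs_le_sqrt ?_
  exact Finset.single_le_sum (f := fun j => ((x j : ℝ)) ^ 2) (fun j _ => sq_nonneg _)
    (Finset.mem_univ i)

/-- The Euclidean norm tends to `∞` along the cofinite filter of `ℤ^d`. -/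
theorem tendsto_sqrt_sum_sq_cofinite (d : ℕ) :
    Tendsto (fun x : Site d => Real.sqrt (∑ i, ((x i : ℝ)) ^ 2)) cofinite atTop :=
  tendsto_atTop_mono norm_le_sqrt_sum_sq Site.tendsto_norm_cofinite_atTop

/-! ### The step function of a series -/

/-- The step function `u ↦ (L/2)(b_{2k} + b_{2k+1})`, `k = ⌊uL/2⌋`, is measurable. -/
theorem measurable_step (b : ℕ → ℝ) (L : ℝ) :
    Measurable fun u : ℝ => L / 2 * (b (2 * ⌊u * L / 2⌋₊) + b (2 * ⌊u * L / 2⌋₊ + 1)) := by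
  have h : (fun u : ℝ => L / 2 * (b (2 * ⌊u * L / 2⌋₊) + b (2 * ⌊u * L / 2⌋₊ + 1))) =
      (fun k : ℕ => L / 2 * (b (2 * k) + b (2 * k + 1))) ∘ fun u : ℝ => ⌊u * L / 2⌋₊ := rfl
  rw [h]
  exact measurable_from_nat.comp
    (Nat.measurable_floor.comp ((measurable_id.mul_const _).div_const _))

/-- On the cell `[2k/L, (2k+2)/L)` the index `⌊uL/2⌋` equals `k` (`L > 0`). -/
theorem floor_eq_of_mem_Ico {L : ℝ} (hL : 0 < L) {k : ℕ} {u : ℝ}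
    (hu : u ∈ Ico (2 * (k : ℝ) / L) ((2 * (k : ℝ) + 2) / L)) : ⌊u * L / 2⌋₊ = k := by
  obtain ⟨h1, h2⟩ := hu
  have hu0 : 0 ≤ u := le_trans (by positivity) h1
  have h1' : (k : ℝ) ≤ u * L / 2 := by
    rw [div_le_iff₀ hL] at h1
    linarith
  have h2' : u * L / 2 < k + 1 := by
    rw [lt_div_iff₀ hL] at h2
    linarith
  exact (Nat.floor_eq_iff (by positivity)).2 ⟨h1', h2'⟩

/-- The cells `[2k/L, (2k+2)/L)`, `k ∈ ℕ`, cover `[0, ∞)` (`L > 0`). -/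
theorem iUnion_Ico_eq_Ici {L : ℝ} (hL : 0 < L) :
    (⋃ k : ℕ, Ico (2 * (k : ℝ) / L) ((2 * (k : ℝ) + 2) / L)) = Ici 0 := by
  ext u
  simp only [mem_iUnion, mem_Ico, mem_Ici]
  constructor
  · rintro ⟨k, hk, -⟩
    exact le_trans (by positivity) hk
  · intro hu
    refine ⟨⌊u * L / 2⌋₊, ?_, ?_⟩
    · rw [div_le_iff₀ hL]
      have := Nat.floor_le (a := u * L / 2) (by positivity)
      linarith
    · rw [lt_div_iff₀ hL]
      have := Nat.lt_floor_add_one (u * L / 2)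
      linarith

/-- The cells `[2k/L, (2k+2)/L)` are pairwise disjoint (`L > 0`). -/
theorem pairwise_disjoint_Ico {L : ℝ} (hL : 0 < L) :
    Pairwise (Function.onFun Disjoint
      fun k : ℕ => Ico (2 * (k : ℝ) / L) ((2 * (k : ℝ) + 2) / L)) := by
  rw [pairwise_disjoint_on]
  intro m n hmn
  refine Ico_disjoint_Ico.2 ?_
  have h : (2 * (m : ℝ) + 2) / L ≤ 2 * (n : ℝ) / L := by
    apply div_le_div_of_nonneg_right _ hL.le
    have : (m : ℝ) + 1 ≤ n := by exact_mod_cast hmn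
    linarith
  exact (min_le_left _ _).trans (h.trans (le_max_right _ _))

/-- On the cell `[2k/L, (2k+2)/L)` the step function is the constant `(L/2)(b_{2k} + b_{2k+1})`. -/
theorem step_eqOn_cell (b : ℕ → ℝ) {L : ℝ} (hL : 0 < L) (k : ℕ) :
    EqOn (fun u : ℝ => L / 2 * (b (2 * ⌊u * L / 2⌋₊) + b (2 * ⌊u * L / 2⌋₊ + 1)))
      (fun _ => L / 2 * (b (2 * k) + b (2 * k + 1)))
      (Ico (2 * (k : ℝ) / L) ((2 * (k : ℝ) + 2) / L)) := by
  intro u hu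
  simp only [floor_eq_of_mem_Ico hL hu]

/-- The cells have length `2/L`. -/
theorem volume_real_cell {L : ℝ} (hL : 0 < L) (k : ℕ) :
    volume.real (Ico (2 * (k : ℝ) / L) ((2 * (k : ℝ) + 2) / L)) = 2 / L := by
  rw [Real.volume_real_Ico, show (2 * (k : ℝ) + 2) / L - 2 * k / L = 2 / L by ring,
    max_eq_left (by positivity)]

/-- The step function is integrable on each cell. -/
theorem integrableOn_step_cell (b : ℕ → ℝ) {L : ℝ} (hL : 0 < L) (k : ℕ) :
    IntegrableOn (fun u : ℝ => L / 2 * (b (2 * ⌊u * L / 2⌋₊) + b (2 * ⌊u * L / 2⌋₊ + 1)))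
      (Ico (2 * (k : ℝ) / L) ((2 * (k : ℝ) + 2) / L)) volume :=
  (integrableOn_const (measure_Ico_lt_top.ne)).congr_fun (step_eqOn_cell b hL k).symm
    measurableSet_Ico

/-- The integral of the step function over the `k`-th cell is `b_{2k} + b_{2k+1}`. -/
theorem setIntegral_step_cell (b : ℕ → ℝ) {L : ℝ} (hL : 0 < L) (k : ℕ) :
    ∫ u in Ico (2 * (k : ℝ) / L) ((2 * (k : ℝ) + 2) / L),
        L / 2 * (b (2 * ⌊u * L / 2⌋₊) + b (2 * ⌊u * L / 2⌋₊ + 1)) =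
      b (2 * k) + b (2 * k + 1) := by
  rw [setIntegral_congr_fun measurableSet_Ico (step_eqOn_cell b hL k), setIntegral_const,
    volume_real_cell hL k, smul_eq_mul]
  field_simp

/-- The integral of the norm of the step function over the `k`-th cell (`b ≥ 0`). -/
theorem setIntegral_norm_step_cell {b : ℕ → ℝ} (hb0 : ∀ n, 0 ≤ b n) {L : ℝ} (hL : 0 < L)
    (k : ℕ) :
    ∫ u in Ico (2 * (k : ℝ) / L) ((2 * (k : ℝ) + 2) / L),
        ‖L / 2 * (b (2 * ⌊u * L / 2⌋₊) + b (2 * ⌊u * L / 2⌋₊ + 1))‖ =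
      b (2 * k) + b (2 * k + 1) := by
  rw [← setIntegral_step_cell b hL k]
  refine setIntegral_congr_fun measurableSet_Ico fun u _ => ?_
  rw [Real.norm_eq_abs, abs_of_nonneg]
  exact mul_nonneg (by positivity) (add_nonneg (hb0 _) (hb0 _))

/-- For a non-negative summable `b`, the pairs `b_{2k} + b_{2k+1}` sum to `Σ_n b_n`. -/
theorem hasSum_even_add_odd {b : ℕ → ℝ} (hb : Summable b) :
    HasSum (fun k => b (2 * k) + b (2 * k + 1)) (∑' n, b n) := by
  have he : Summable fun k => b (2 * k) :=
    hb.comp_injective (fun m n h => by simpa using h : Function.Injective fun k : ℕ => 2 * k)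
  have ho : Summable fun k => b (2 * k + 1) :=
    hb.comp_injective (fun m n h => by simpa using h : Function.Injective fun k : ℕ => 2 * k + 1)
  have h := he.hasSum.add ho.hasSum
  rwa [tsum_even_add_odd he ho] at h

/-- **The integral of the step function is the sum of the series.** For `L > 0` and a non-negative
summable `b`, the step function `u ↦ (L/2)(b_{2k} + b_{2k+1})`, `k = ⌊uL/2⌋`, is integrable on
`(0, ∞)` and `∫_{(0,∞)} (L/2)(b_{2k} + b_{2k+1}) du = Σ_n b_n` (each cell has length `2/L` and
carries the two consecutive orders `2k, 2k+1`). -/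
theorem integral_step_eq_tsum {b : ℕ → ℝ} (hb0 : ∀ n, 0 ≤ b n) (hb : Summable b) {L : ℝ}
    (hL : 0 < L) :
    IntegrableOn (fun u : ℝ => L / 2 * (b (2 * ⌊u * L / 2⌋₊) + b (2 * ⌊u * L / 2⌋₊ + 1)))
        (Ioi 0) ∧
      ∫ u in Ioi (0 : ℝ), L / 2 * (b (2 * ⌊u * L / 2⌋₊) + b (2 * ⌊u * L / 2⌋₊ + 1)) =
        ∑' n, b n := by
  have hpair := hasSum_even_add_odd hb
  -- integrability on the union of the cells
  have hU : IntegrableOn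
      (fun u : ℝ => L / 2 * (b (2 * ⌊u * L / 2⌋₊) + b (2 * ⌊u * L / 2⌋₊ + 1)))
      (⋃ k : ℕ, Ico (2 * (k : ℝ) / L) ((2 * (k : ℝ) + 2) / L)) volume := by
    refine integrableOn_iUnion_of_summable_integral_norm (integrableOn_step_cell b hL) ?_
    simp only [setIntegral_norm_step_cell hb0 hL]
    exact hpair.summable
  have hU' := hU
  rw [iUnion_Ico_eq_Ici hL] at hU'
  refine ⟨hU'.mono_set Ioi_subset_Ici_self, ?_⟩
  rw [← integral_Ici_eq_integral_Ioi, ← iUnion_Ico_eq_Ici hL,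
    integral_iUnion (fun k => measurableSet_Ico) (pairwise_disjoint_Ico hL) hU]
  simp only [setIntegral_step_cell b hL]
  exact hpair.tsum_eq

/-! ### Four elementary facts for the dominated-convergence step -/

/-- A convergent real sequence indexed by `ℕ` is bounded above by a non-negative constant times the
normalising power: from `vⁿ Sₙ / n^{γ-1} → C`, `vⁿ Sₙ ≤ C₁ n^{γ-1}` for `n ≥ 1`. -/
theorem exists_growth_bound {S : ℕ → ℝ} {v γ C : ℝ}
    (hRV : Tendsto (fun n : ℕ => v ^ n * S n / (n : ℝ) ^ (γ - 1)) atTop (𝓝 C)) :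
    ∃ C₁ : ℝ, 0 ≤ C₁ ∧ ∀ n : ℕ, 1 ≤ n → v ^ n * S n ≤ C₁ * (n : ℝ) ^ (γ - 1) := by
  obtain ⟨B, hB⟩ := hRV.bddAbove_range
  refine ⟨max B 0, le_max_right _ _, fun n hn => ?_⟩
  have h : v ^ n * S n / (n : ℝ) ^ (γ - 1) ≤ B := hB (Set.mem_range_self n)
  have hnpos : 0 < (n : ℝ) ^ (γ - 1) := Real.rpow_pos_of_pos (by exact_mod_cast hn) _
  rw [div_le_iff₀ hnpos] at h
  exact h.trans (mul_le_mul_of_nonneg_right (le_max_left _ _) hnpos.le)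

/-- The limit profile `f(u) = C u^{γ-1-3ν} Q(u^{-ν})` is continuous on `(0, ∞)`. -/
theorem continuousOn_profile {ν γ C : ℝ} {Q : ℝ → ℝ} (hQc : ContinuousOn Q (Ici 0)) :
    ContinuousOn (fun u : ℝ => C * u ^ (γ - 1 - 3 * ν) * Q (u ^ (-ν))) (Ioi 0) := by
  refine ContinuousOn.mul (continuousOn_const.mul ?_) ?_
  · exact fun u hu => (Real.continuousAt_rpow_const u _ (Or.inl (ne_of_gt hu))).continuousWithinAt
  · refine hQc.comp ?_ ?_
    · exact fun u hu =>
        (Real.continuousAt_rpow_const u _ (Or.inl (ne_of_gt hu))).continuousWithinAt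
    · exact fun u hu => Real.rpow_nonneg (le_of_lt hu) _

/-- The limit profile is positive somewhere on `(0, ∞)` if `Q ≥ 0` is continuous on `[0, ∞)` and
positive somewhere (`C > 0`). -/
theorem exists_profile_pos {ν γ C : ℝ} {Q : ℝ → ℝ} (hν : 0 < ν) (hC : 0 < C)
    (hQc : ContinuousOn Q (Ici 0)) (hQpos : ∃ s, 0 ≤ s ∧ 0 < Q s) :
    ∃ u₀ : ℝ, 0 < u₀ ∧ 0 < C * u₀ ^ (γ - 1 - 3 * ν) * Q (u₀ ^ (-ν)) := by
  obtain ⟨s₀, hs₀, hQs₀⟩ := hQpos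
  have hev : ∀ᶠ s in 𝓝[Ici 0] s₀, Q s₀ / 2 < Q s :=
    (hQc s₀ hs₀).tendsto.eventually (lt_mem_nhds (by linarith))
  obtain ⟨δ, hδ, hball⟩ := Metric.eventually_nhds_iff.1 (eventually_nhdsWithin_iff.1 hev)
  have hs₁ : 0 < s₀ + δ / 2 := by linarith
  have hQs₁ : 0 < Q (s₀ + δ / 2) := by
    have h := hball (y := s₀ + δ / 2)
      (by rw [Real.dist_eq, show s₀ + δ / 2 - s₀ = δ / 2 by ring, abs_of_pos (by linarith)]
          linarith)
      (show s₀ + δ / 2 ∈ Ici 0 from hs₁.le)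
    linarith
  refine ⟨(s₀ + δ / 2) ^ (-(1 / ν)), Real.rpow_pos_of_pos hs₁ _, ?_⟩
  have hid : ((s₀ + δ / 2) ^ (-(1 / ν))) ^ (-ν) = s₀ + δ / 2 := by
    rw [← Real.rpow_mul hs₁.le, show (-(1 / ν)) * (-ν) = 1 by field_simp, Real.rpow_one]
  rw [hid]
  exact mul_pos (mul_pos hC (Real.rpow_pos_of_pos (Real.rpow_pos_of_pos hs₁ _) _)) hQs₁

/-- A non-negative function, continuous on `(0, ∞)`, integrable there and positive somewhere, has
positive integral over `(0, ∞)`. -/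
theorem setIntegral_Ioi_pos_of_continuousOn {f : ℝ → ℝ} (hcont : ContinuousOn f (Ioi 0))
    (hint : IntegrableOn f (Ioi 0)) (hnn : ∀ u, 0 < u → 0 ≤ f u) {u₀ : ℝ} (hu₀ : 0 < u₀)
    (hfu₀ : 0 < f u₀) : 0 < ∫ u in Ioi 0, f u := by
  have hca : ContinuousAt f u₀ := hcont.continuousAt (Ioi_mem_nhds hu₀)
  have hev : ∀ᶠ u in 𝓝 u₀, f u₀ / 2 < f u := hca.eventually (lt_mem_nhds (by linarith))
  obtain ⟨δ, hδ, hball⟩ := Metric.eventually_nhds_iff.1 hev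
  have hsub : Ioo u₀ (u₀ + δ) ⊆ Function.support f ∩ Ioi 0 := by
    intro u hu
    refine ⟨?_, hu₀.trans hu.1⟩
    have h : f u₀ / 2 < f u := hball (by
      rw [Real.dist_eq, abs_of_pos (by linarith [hu.1])]
      linarith [hu.2])
    exact (show 0 < f u by linarith).ne'
  rw [setIntegral_pos_iff_support_of_nonneg_ae ?_ hint]
  · calc (0 : ENNReal) < volume (Ioo u₀ (u₀ + δ)) := by simp [Real.volume_Ioo, hδ]
      _ ≤ volume (Function.support f ∩ Ioi 0) := measure_mono hsub
  · exact (ae_restrict_iff' measurableSet_Ioi).2 (ae_of_all _ fun u hu => hnn u hu)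

end Summit.CriticalPhenomena.Ising3DConformalLimit.Theorems.KernelTransfer

end
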